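import Mathlib
import HarnessLib
import Literature.Analysis.Fourier.TorusGridPoissonSummation

/-!
# The aliased tail of a product (trigonometric polynomial) × (smooth torus function)

Topic `Literature/Analysis/Fourier`; namespace `Literature.Analysis.Fourier`.  Companion of `TorusGridPoissonSummation`: the aliasing error of the
`N`-grid quadrature of `f = P·g`, `P = Σ_{y ∈ B} c_y e_y` a trigonometric polynomial with frequencies `2|y_i| < N` and `g ∈ C((ℝ/ℤ)^d)` with absolutely
summable coefficients, is at most `(Σ_y |c_y|)·Σ_{x : ∃ i, 2|x_i| ≥ N} |ĝ(x)|` — the coefficient mass of `P` times the TAIL of `ĝ` beyond `N/2`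
(`tsum_aliased_norm_mFourierCoeff_trigPoly_mul_le`).  Ingredients: the shift rule `(e_y g)^(k) = ĝ(k − y)` (`mFourierCoeff_mFourier_mul`), linearity, and the
observation that an aliased frequency `k ≠ 0`, `N ∣ k`, has `|k_i| ≥ N` for some `i`, whence `2|k_i − y_i| ≥ N`.  This is the standard estimate behind
"aliasing errors are controlled by the neglected coefficients" [cite: Boyd2001, §4.5 Theorem 20 (4.47)] for a product whose first factor is exactly
resolved by the grid.

Used by the Hubbard `KLProgramme` (lane c4a-1, LAYER 2: lattice loop sum `Σ_q ŝ(e_K(q))·Ṽ(k,q)` with `Ṽ(k,·)` the four-leg kernel's own trigonometric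
polynomial and `ŝ∘e_K` the smooth slice function — the aliasing is the slice function's coefficient tail beyond `L/2` times `‖Ṽ(k,·)‖_{ℓ¹}`).
-/

noncomputable section

open Complex Finset UnitAddTorus MeasureTheory

namespace Literature.Analysis.Fourier

variable {d : Type*} [Fintype d]

/-- **Shift rule**: the Fourier coefficients of `e_y · g` are those of `g` shifted by `y`. [cite: Boyd2001, §4.5 Theorem 19 (4.44)] -/
theorem mFourierCoeff_mFourier_mul (g : UnitAddTorus d → ℂ) (y k : d → ℤ) :
    mFourierCoeff (fun x => mFourier y x * g x) k = mFourierCoeff g (k - y) := by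
  unfold mFourierCoeff
  congr 1
  funext t
  rw [smul_eq_mul, smul_eq_mul, ← mul_assoc, ← mFourier_add]
  congr 2
  abel

/-- **Coefficients of (trigonometric polynomial) × g**: `(Σ_{y∈B} c_y e_y · g)^(k) = Σ_{y∈B} c_y ĝ(k − y)`. [cite: Boyd2001, §4.5 Theorem 19 (4.44)] -/
theorem mFourierCoeff_trigPoly_mul (g : C(UnitAddTorus d, ℂ)) (B : Finset (d → ℤ)) (c : (d → ℤ) → ℂ) (k : d → ℤ) :
    mFourierCoeff (fun x => (∑ y ∈ B, c y * mFourier y x) * g x) k = ∑ y ∈ B, c y * mFourierCoeff g (k - y) := by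
  -- the measure normalisation of `Mathlib.Analysis.Fourier.AddCircleMulti` (total volume 1 on `ℝ/ℤ`), inside the proof only
  letI : MeasureSpace UnitAddCircle := ⟨AddCircle.haarAddCircle⟩
  haveI : IsProbabilityMeasure (volume : Measure UnitAddCircle) := inferInstanceAs (IsProbabilityMeasure AddCircle.haarAddCircle)
  have hterm : ∀ y ∈ B, Integrable (fun t : UnitAddTorus d => mFourier (-k) t • (c y * mFourier y t * g t)) := fun y _ =>
    (((mFourier (-k)).continuous).smul ((continuous_const.mul (mFourier y).continuous).mul g.continuous)).integrable_of_hasCompactSupport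
      (HasCompactSupport.of_compactSpace _)
  have h1 : mFourierCoeff (fun x => (∑ y ∈ B, c y * mFourier y x) * g x) k =
      ∫ t : UnitAddTorus d, ∑ y ∈ B, mFourier (-k) t • (c y * mFourier y t * g t) := by
    unfold mFourierCoeff
    congr 1
    all_goals first | rfl | (funext t; simp only [Finset.sum_mul, Finset.smul_sum])
  rw [h1, integral_finsetSum B hterm]
  refine Finset.sum_congr rfl fun y _ => ?_
  rw [← mFourierCoeff_mFourier_mul g y k]
  unfold mFourierCoeff
  rw [← integral_const_mul]
  congr 1
  all_goals first | rfl | (funext t; simp only [smul_eq_mul]; ring)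

omit [Fintype d] in
/-- An aliased frequency (`k ≠ 0`, `N ∣ k_i` for all `i`) shifted by a resolved one (`2|y_i| < N`) stays in the tail `∃ i, N ≤ 2|k_i − y_i|`.
[cite: Boyd2001, §4.5 Theorem 20 (4.47)] -/
theorem exists_le_two_mul_abs_sub_of_aliased {N : ℕ} {k y : d → ℤ} (hk0 : k ≠ 0) (hk : ∀ i, (N : ℤ) ∣ k i)
    (hy : ∀ i, 2 * |y i| < N) : ∃ i, (N : ℤ) ≤ 2 * |k i - y i| := by
  obtain ⟨i, hi⟩ := Function.ne_iff.1 hk0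
  have hi' : k i ≠ 0 := by simpa using hi
  refine ⟨i, ?_⟩
  have h1 : (N : ℤ) ≤ |k i| := Int.le_of_dvd (abs_pos.2 hi') ((dvd_abs _ _).2 (hk i))
  have h2 : |k i| - |y i| ≤ |k i - y i| := abs_sub_abs_le_abs_sub _ _
  have h3 := hy i
  linarith

/-- **The aliased tail of a product.**  For `P = Σ_{y∈B} c_y e_y` with `2|y_i| < N` on `B` and `g ∈ C((ℝ/ℤ)^d)` with absolutely summable coefficients:
`Σ_{k ≠ 0, N ∣ k} ‖(P·g)^(k)‖ ≤ (Σ_{y∈B} ‖c_y‖) · Σ_{x : ∃ i, N ≤ 2|x_i|} ‖ĝ(x)‖`. [cite: Boyd2001, §4.5 Theorem 20 (4.47)] -/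
theorem tsum_aliased_norm_mFourierCoeff_trigPoly_mul_le (N : ℕ) (g : C(UnitAddTorus d, ℂ)) (hg : Summable (mFourierCoeff g))
    (B : Finset (d → ℤ)) (c : (d → ℤ) → ℂ) (hB : ∀ y ∈ B, ∀ i, 2 * |y i| < N) :
    ∑' k : d → ℤ, (if k ≠ 0 ∧ ∀ i, (N : ℤ) ∣ k i then ‖mFourierCoeff (fun x => (∑ y ∈ B, c y * mFourier y x) * g x) k‖ else 0) ≤
      (∑ y ∈ B, ‖c y‖) * ∑' x : d → ℤ, (if ∃ i, (N : ℤ) ≤ 2 * |x i| then ‖mFourierCoeff g x‖ else 0) := by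
  classical
  have hgn : Summable fun x : d → ℤ => ‖mFourierCoeff g x‖ := hg.norm
  -- the tail series and its shifts are summable
  have htail : ∀ y : d → ℤ, Summable fun k : d → ℤ =>
      (if ∃ i, (N : ℤ) ≤ 2 * |k i - y i| then ‖mFourierCoeff g (k - y)‖ else 0) := by
    intro y
    have h := (hgn.comp_injective (Equiv.subRight y).injective)
    refine Summable.of_nonneg_of_le (fun k => by positivity) (fun k => ?_) h
    split_ifs
    · exact le_rfl
    · exact norm_nonneg _
  have hshift : ∀ y : d → ℤ, Summable fun k : d → ℤ => ‖c y‖ * ‖mFourierCoeff g (k - y)‖ := fun y =>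
    (hgn.comp_injective (Equiv.subRight y).injective).mul_left _
  -- pointwise bound of the aliased summand
  have hpt : ∀ k : d → ℤ,
      (if k ≠ 0 ∧ ∀ i, (N : ℤ) ∣ k i then ‖mFourierCoeff (fun x => (∑ y ∈ B, c y * mFourier y x) * g x) k‖ else 0) ≤
        ∑ y ∈ B, ‖c y‖ * (if ∃ i, (N : ℤ) ≤ 2 * |k i - y i| then ‖mFourierCoeff g (k - y)‖ else 0) := by
    intro k
    split_ifs with hk
    · rw [mFourierCoeff_trigPoly_mul]
      refine (norm_sum_le _ _).trans (Finset.sum_le_sum fun y hy => ?_)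
      rw [norm_mul, if_pos (exists_le_two_mul_abs_sub_of_aliased hk.1 hk.2 (hB y hy))]
    · exact Finset.sum_nonneg fun y _ => by positivity
  have hsumR : Summable fun k : d → ℤ =>
      ∑ y ∈ B, ‖c y‖ * (if ∃ i, (N : ℤ) ≤ 2 * |k i - y i| then ‖mFourierCoeff g (k - y)‖ else 0) :=
    summable_sum fun y _ => (htail y).mul_left _
  have hsumL : Summable fun k : d → ℤ =>
      (if k ≠ 0 ∧ ∀ i, (N : ℤ) ∣ k i then ‖mFourierCoeff (fun x => (∑ y ∈ B, c y * mFourier y x) * g x) k‖ else 0) :=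
    Summable.of_nonneg_of_le (fun k => by positivity) hpt hsumR
  refine (Summable.tsum_le_tsum hpt hsumL hsumR).trans (le_of_eq ?_)
  rw [Summable.tsum_finsetSum (fun y _ => (htail y).mul_left _), Finset.sum_mul]
  refine Finset.sum_congr rfl fun y _ => ?_
  rw [tsum_mul_left]
  congr 1
  exact (Equiv.subRight y).tsum_eq (fun x : d → ℤ => if ∃ i, (N : ℤ) ≤ 2 * |x i| then ‖mFourierCoeff g x‖ else 0)

/-! ## The non-strict frequency box `2|y_i| ≤ N` (even `N`: the centred representatives of `ℤ/N` reach `N/2`) -/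

omit [Fintype d] in
/-- `exists_le_two_mul_abs_sub_of_aliased` with the NON-STRICT resolution hypothesis `2|y_i| ≤ N` (needed when `N` is even and the centred frequency box
is closed on one side: `|k_i| ≥ N` and `|y_i| ≤ N/2` still give `2|k_i − y_i| ≥ N`). [cite: Boyd2001, §4.5 Theorem 20 (4.47)] -/
theorem exists_le_two_mul_abs_sub_of_aliased' {N : ℕ} {k y : d → ℤ} (hk0 : k ≠ 0) (hk : ∀ i, (N : ℤ) ∣ k i)
    (hy : ∀ i, 2 * |y i| ≤ N) : ∃ i, (N : ℤ) ≤ 2 * |k i - y i| := by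
  obtain ⟨i, hi⟩ := Function.ne_iff.1 hk0
  have hi' : k i ≠ 0 := by simpa using hi
  refine ⟨i, ?_⟩
  have h1 : (N : ℤ) ≤ |k i| := Int.le_of_dvd (abs_pos.2 hi') ((dvd_abs _ _).2 (hk i))
  have h2 : |k i| - |y i| ≤ |k i - y i| := abs_sub_abs_le_abs_sub _ _
  have h3 := hy i
  linarith

/-- **The aliased tail of a product, non-strict frequency box.**  For `P = Σ_{y∈B} c_y e_y` with `2|y_i| ≤ N` on `B` and `g ∈ C((ℝ/ℤ)^d)` with absolutely summable coefficients:
`Σ_{k ≠ 0, N ∣ k} ‖(P·g)^(k)‖ ≤ (Σ_{y∈B} ‖c_y‖) · Σ_{x : ∃ i, N ≤ 2|x_i|} ‖ĝ(x)‖`. [cite: Boyd2001, §4.5 Theorem 20 (4.47)] -/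
theorem tsum_aliased_norm_mFourierCoeff_trigPoly_mul_le' (N : ℕ) (g : C(UnitAddTorus d, ℂ)) (hg : Summable (mFourierCoeff g))
    (B : Finset (d → ℤ)) (c : (d → ℤ) → ℂ) (hB : ∀ y ∈ B, ∀ i, 2 * |y i| ≤ N) :
    ∑' k : d → ℤ, (if k ≠ 0 ∧ ∀ i, (N : ℤ) ∣ k i then ‖mFourierCoeff (fun x => (∑ y ∈ B, c y * mFourier y x) * g x) k‖ else 0) ≤
      (∑ y ∈ B, ‖c y‖) * ∑' x : d → ℤ, (if ∃ i, (N : ℤ) ≤ 2 * |x i| then ‖mFourierCoeff g x‖ else 0) := by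
  classical
  have hgn : Summable fun x : d → ℤ => ‖mFourierCoeff g x‖ := hg.norm
  -- the tail series and its shifts are summable
  have htail : ∀ y : d → ℤ, Summable fun k : d → ℤ =>
      (if ∃ i, (N : ℤ) ≤ 2 * |k i - y i| then ‖mFourierCoeff g (k - y)‖ else 0) := by
    intro y
    have h := (hgn.comp_injective (Equiv.subRight y).injective)
    refine Summable.of_nonneg_of_le (fun k => by positivity) (fun k => ?_) h
    split_ifs
    · exact le_rfl
    · exact norm_nonneg _
  have hshift : ∀ y : d → ℤ, Summable fun k : d → ℤ => ‖c y‖ * ‖mFourierCoeff g (k - y)‖ := fun y =>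
    (hgn.comp_injective (Equiv.subRight y).injective).mul_left _
  -- pointwise bound of the aliased summand
  have hpt : ∀ k : d → ℤ,
      (if k ≠ 0 ∧ ∀ i, (N : ℤ) ∣ k i then ‖mFourierCoeff (fun x => (∑ y ∈ B, c y * mFourier y x) * g x) k‖ else 0) ≤
        ∑ y ∈ B, ‖c y‖ * (if ∃ i, (N : ℤ) ≤ 2 * |k i - y i| then ‖mFourierCoeff g (k - y)‖ else 0) := by
    intro k
    split_ifs with hk
    · rw [mFourierCoeff_trigPoly_mul]
      refine (norm_sum_le _ _).trans (Finset.sum_le_sum fun y hy => ?_)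
      rw [norm_mul, if_pos (exists_le_two_mul_abs_sub_of_aliased' hk.1 hk.2 (hB y hy))]
    · exact Finset.sum_nonneg fun y _ => by positivity
  have hsumR : Summable fun k : d → ℤ =>
      ∑ y ∈ B, ‖c y‖ * (if ∃ i, (N : ℤ) ≤ 2 * |k i - y i| then ‖mFourierCoeff g (k - y)‖ else 0) :=
    summable_sum fun y _ => (htail y).mul_left _
  have hsumL : Summable fun k : d → ℤ =>
      (if k ≠ 0 ∧ ∀ i, (N : ℤ) ∣ k i then ‖mFourierCoeff (fun x => (∑ y ∈ B, c y * mFourier y x) * g x) k‖ else 0) :=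
    Summable.of_nonneg_of_le (fun k => by positivity) hpt hsumR
  refine (Summable.tsum_le_tsum hpt hsumL hsumR).trans (le_of_eq ?_)
  rw [Summable.tsum_finsetSum (fun y _ => (htail y).mul_left _), Finset.sum_mul]
  refine Finset.sum_congr rfl fun y _ => ?_
  rw [tsum_mul_left]
  congr 1
  exact (Equiv.subRight y).tsum_eq (fun x : d → ℤ => if ∃ i, (N : ℤ) ≤ 2 * |x i| then ‖mFourierCoeff g x‖ else 0)

end Literature.Analysis.Fourier
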